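import Summits.HubbardSuperconductivity.HubbardSuperconductivity.Theorems.BalabanIRBirGappedPhaseReductionRLogic

/-!
# Route BalabanIR — crux 4R `BirGappedPhaseReductionR` (item `stmt-HubbardSuperconductivity-14846`):
# the MEMBERSHIP ∧ TRANSFER shape that consumes the restated engine AS TYPED

`BirGappedPhaseReductionR := BirComplexStableXYR → BirBdGPhaseCoercivity → BirGroundStateAverageLRO`.
With crux 3 closed (`BirBdGPhaseCoercivity_holds`) the item is literally `BirComplexStableXYR →
BirGroundStateAverageLRO` (`birGappedPhaseReductionR_iff_engineR_imp_target`).  Every line planned for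
the item (Cruxes/BirGappedPhaseReductionR/Ideas/*, line chirality-sheet-peierls) ends in a stub of the
form "membership ∧ transfer": a statement about `hubbardTorus` ALONE which, fed the thresholds
`(K₀, L₀)` that the engine `BirComplexStableXYR` provides for a window class `(r, B, c₀)`, returns a
weak-coupling window on which, eventually in even `L` and frequently in `β`, SOME admissible window
table `c` at SOME stiffness `K ≥ K₀` and SOME even `M ≥ L` has the property that the engine's
conclusion for `(K, c, L, M)` implies the canonical-sector thermal `d`-wave pair bound `cP·L⁴`.

This `--supports` module records, kernel-checked, that this shape — spelled out below as the
hypothesis `hMT` of `birGappedPhaseReductionR_of_membershipTransfer`, with the six admissibility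
hypotheses (U1) (N) (A) (C) (R) (P) and the conclusion `Z ≠ 0 ∧ 1/2 ≤ Re(N/Z)` of
`BirComplexStableXYR` copied VERBATIM — composes with the restated engine exactly as typed
(quantifier order `∀ r B c₀ ∃ K₀ L₀ ∀ K ∀ c ∀ L M` against `∃ r B c₀ ∀ K₀ L₀ ∃ window ∀ U ∃ L₁ ∀ L
∃ᶠ β ∃ K ∃ c ∃ M`) to give `BirGappedPhaseReductionR`, the `β → ∞` endgame being the Theses-free
bridge already landed (`birGappedPhaseReductionR_of_engineR_imp_frequently_thermal`).  So the first
antecedent `h2R` is NOT inert for a Hubbard-side statement of this shape (it is inert only for EXACT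
membership of the fermion-induced weight in the finite-table class,
`Negative.NoExactFiniteTable.cexp_ne_affine_cos`): all the slack a constructive proof needs (auxiliary
exactly-admissible table, comparison errors, the factor between slice order and pair order) lives in
the implication `engine conclusion → thermal bound`, chosen `β` by `β`.  This is the text proposed for
the planner's restated item 14846′ (line lead pass c1, PICKED.md); the present item then follows from
14846′ by this theorem, and 14846′ is what the lines' `stub_membershipTransfer` must prove.
Calibration of the shape: for SMALL thresholds the inner implication can be discharged vacuously
(at `K = 0` the slice order is `1/L² < 1/2`), so all the content of `hMT` sits at large `(K₀, L₀)`,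
exactly where the engine's conclusion holds for every admissible table if `BirComplexStableXYR` is
true; were the engine false, `hMT` and the item would both hold vacuously
(`birGappedPhaseReductionR_of_not_engineR`).  The admissible class is non-empty at
`(r, B, c₀) = (2, 64(1+e²), 1)` (`Negative.XYPairTable`, landed), so `hMT` cannot fail for want of a table.

Pure logic over the route's definitions plus the landed thermal bridge (H. Tasaki, *Physics and
Mathematics of Quantum Many-Body Systems* (2020), App. A).  Folklore; no definition is introduced.
-/

noncomputable section

set_option linter.dupNamespace false

namespace Summit.HubbardSuperconductivity.HubbardSuperconductivity.Theorems

open Filter Matrix Literature.MathematicalPhysics.QuantumLattice Literature.Probability.LatticeModels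
open Summit.HubbardSuperconductivity.HubbardSuperconductivity.Theses.BalabanIR

/-- **MEMBERSHIP ∧ TRANSFER consumes the restated engine as typed.**  If (hypothesis `hMT`) for some
`δ ∈ (0,1/2)` and some window class `(r, B, c₀)`, `r ≥ 2`, `c₀ > 0`, EVERY pair of thresholds
`(K₀, L₀)` admits a coupling window `(U₁, U₂) ⊂ (0, ∞)` and `cP > 0` such that for every `U` in the
window, eventually in even `L`, frequently in `β`, there are `K ≥ K₀`, a window table `c` satisfying
(U1), (N), (A) with budget `B`, (C) with constant `c₀`, (R), (P), and an even `M ≥ L` with `L ≥ L₀`,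
for which the engine conclusion `Z ≠ 0 ∧ 1/2 ≤ Re(N/Z)` at `(K, c, L, M)` IMPLIES the bound
`cP·L⁴ ≤ Re[tr(P_S e^{-βH} Δ_d†Δ_d)/tr(P_S e^{-βH})]` for `H = hubbardTorus 2 L 1 U` in the sector
`(2⌊(1-δ)L²/2⌋, S^z = 0)` — then `BirGappedPhaseReductionR` holds: instantiate the engine at
`(r, B, c₀)`, feed its `(K₀, L₀)` to `hMT`, discharge the implication with the engine's conclusion,
and finish with `birGappedPhaseReductionR_of_engineR_imp_frequently_thermal`. [folklore] -/
theorem birGappedPhaseReductionR_of_membershipTransfer :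
    (∃ δ ∈ Set.Ioo (0:ℝ) (1/2), ∃ (r : ℕ) (B c₀ : ℝ), 2 ≤ r ∧ 0 < c₀ ∧ ∀ (K₀ : ℝ) (L₀ : ℕ), ∃ U₁ U₂ cP : ℝ, 0 < U₁ ∧ U₁ < U₂ ∧ 0 < cP ∧ ∀ U ∈ Set.Ioo U₁ U₂, ∃ L₁ : ℕ, ∀ (L : ℕ) [NeZero L], L₁ ≤ L → Even L → let N : ℕ := 2 * ⌊(1 - δ) * (L : ℝ) ^ 2 / 2⌋₊; let H := hubbardTorus 2 L 1 U; let S := szSector (Λ := FermionTorus 2 L) N 0; let PS := projMatrix (S.map (Fock.toEuclidean (ι := Orb (FermionTorus 2 L)) : Fock (Orb (FermionTorus 2 L)) →ₗ[ℂ] EuclideanSpace ℂ (Finset (Orb (FermionTorus 2 L))))); ∃ᶠ β : ℝ in atTop, ∃ K : ℝ, K₀ ≤ K ∧ ∃ c : ((Fin r × Fin r × Fin r) → ℤ) →₀ ℂ, (∀ n ∈ c.support, ∑ w, n w = 0) ∧ c.sum (fun _ a => a) = 0 ∧ c.sum (fun n a => ‖a‖ * Real.exp (∑ w, |(n w : ℝ)|))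 ≤ B ∧ (∀ φ : (Fin r × Fin r × Fin r) → ℝ, c₀ * ∑ w, ∑ w', (1 - Real.cos (φ w - φ w')) ≤ ((fun (φ : (Fin r × Fin r × Fin r) → ℝ) => c.sum (fun n a => a * Complex.exp (Complex.I * ((∑ w, (n w : ℝ) * φ w : ℝ) : ℂ)))) φ).re) ∧ (∀ n : (Fin r × Fin r × Fin r) → ℤ, c (fun w => n (w.1, w.2.1, Fin.rev w.2.2)) = (starRingEnd ℂ) (c (-n))) ∧ (∀ n : (Fin r × Fin r × Fin r) → ℤ, c (fun w => n (Fin.rev w.1, Fin.rev w.2.1, w.2.2)) = c n) ∧ ∃ M : ℕ, ∃ _ : NeZero M, L₀ ≤ L ∧ L ≤ M ∧ Even M ∧ ((let sh : (Literature.Probability.LatticeModels.TorusSite 2 L × ZMod M) → (Fin r × Fin r × Fin r) → (Literature.Probability.LatticeModels.TorusSite 2 L × ZMod M) := fun s w => (s.1 + ![((w.1 : ℕ) : ZMod L), ((w.2.1 : ℕ) : ZMod L)], s.2 + ((w.2.2 : ℕ) : ZMod M)); let F : ((Fin r × Fin r × Fin r) → ℝ) → ℂ := fun (φ : (Fin r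 × Fin r × Fin r) → ℝ) => c.sum (fun n a => a * Complex.exp (Complex.I * ((∑ w, (n w : ℝ) * φ w : ℝ) : ℂ))); let A : ((Literature.Probability.LatticeModels.TorusSite 2 L × ZMod M) → ℝ) → ℂ := fun θ => (K : ℂ) * ∑ s : (Literature.Probability.LatticeModels.TorusSite 2 L × ZMod M), F (fun w => θ (sh s w)); let cube : Set ((Literature.Probability.LatticeModels.TorusSite 2 L × ZMod M) → ℝ) := Set.pi Set.univ (fun _ => Set.Icc (0:ℝ) (2 * Real.pi)); let Z : ℂ := MeasureTheory.integral (MeasureTheory.volume.restrict cube) (fun θ => Complex.exp (-(A θ))); let O : ((Literature.Probability.LatticeModels.TorusSite 2 L × ZMod M) → ℝ) → ℝ := fun θ => ‖∑ x : Literature.Probability.LatticeModels.TorusSite 2 L, Complex.exp (Complex.I * (θ (x, 0) : ℂ))‖ ^ 2 / (L : ℝ) ^ 4; Z ≠ 0 ∧ (1/2 : ℝ) ≤ ((MeasureTheory.integral (MeasureTheory.volume.restrict cube) (fun θ => (O θ : ℂ) * Complex.exp (-(A θ)))) / Z).re) → cP * (L : ℝ) ^ 4 ≤ ((PS * gibbsWeight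 β H * ((pairField dWaveFormFactor L)ᴴ * pairField dWaveFormFactor L)).trace / (PS * gibbsWeight β H).trace).re)) → BirGappedPhaseReductionR := by
  intro hMT
  refine birGappedPhaseReductionR_of_engineR_imp_frequently_thermal ?_
  intro h2R
  obtain ⟨δ, hδ, r, B, c₀, hr, hc₀, hMT⟩ := hMT
  obtain ⟨K₀, L₀, hE⟩ := h2R r B c₀ hr hc₀
  obtain ⟨U₁, U₂, cP, hU₁, hU₁₂, hcP, hW⟩ := hMT K₀ L₀
  refine ⟨δ, hδ, U₁, U₂, cP, hU₁, hU₁₂, hcP, fun U hU => ?_⟩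
  obtain ⟨L₁, hL⟩ := hW U hU
  refine ⟨L₁, fun L _ hL₁ hLe => ?_⟩
  have key := hL L hL₁ hLe
  dsimp only at key ⊢
  refine key.mono ?_
  rintro β ⟨K, hK, c, h1, h2, h3, h4, h5, h6, M, hM, hL₀, hLM, hMe, himp⟩
  exact himp (hE K hK c h1 h2 h3 h4 h5 h6 L M hL₀ hLM hLe hMe)

end Summit.HubbardSuperconductivity.HubbardSuperconductivity.Theorems
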